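import Summits.CriticalPhenomena.PercolationContinuityZ3.Theorems.PercNearOneGluingNoHeavyConstsSingleEdgeDisconnection
import Literature.Probability.Percolation.TwoSetExchange
import Mathlib.LinearAlgebra.Matrix.Determinant.Basic
import HarnessLib
import HarnessLib.Audit.Tags

/-!
# The single-edge chain rule: the row-split normal form, the "row-avoiding" chain rule (THEOREM), and the chain rule
# in the regime `a₃ ≥ c₁` (PAPER-2 track (ii): constants of the CSH family)

builds on p205010 (kernel theorem, internal audit signed; external expert review pending).  Support file (`--supports
stmt-CriticalPhenomena-4575`), seat `prim-consts-2` (gen 7); rows A6/A11 of `run/shared/lean/prim/consts/CONSTANTS.md`; memo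
`run/shared/lean/prim/consts/FROM-prim-consts-2-g7-ROW-SPLIT.md`.  No definitions, no named facts, no sorries; standard axioms.

Notation: `K(S,T) = μ{S ↮ T}` (the disconnection kernel, `μ = prodBernoulli w`), `S₁ = {x} ⊂ S₂ = {x,u} ⊂ S₃ = {x,u,v}`,
`Yv = Y ∪ {v}`, `Yo = Y ∪ {o}`, `Yvo = Y ∪ {v,o}`.  The single-edge chain rule CR (`Consts.SingleEdgeChainRule`, OPEN) is
`0 ≤ Δ := det [[K(S₁,Yv), K(S₁,Y), K(S₁,Yo)], [K(S₂,Yv), K(S₂,Y), K(S₂,Yo)], [0, K(S₃,Y), K(S₃,Yo)]]`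
(`Consts.singleEdgeChainRule_iff_det_nonneg`); in conditional form, with `a_i = P(o ∈ C_{S_i} | S_i ↮ Y)`,
`b_i = P(v ∈ C_{S_i} | S_i ↮ Y)`, `t_i = 1 − b_i`: `t₂ (a₃ − a₁) ≥ t₁ (a₃ − a₂)`.

Split the FIRST ROW according to whether `v ∈ C_x`: `K(S₁,T) = μ{x ↮ T, v ∉ C_x} + μ{x ↮ T, v ∈ C_x}`; the part with `v ∉ C_x` is the
row `(K(S₁,Yv), K(S₁,Yv), K(S₁,Yvo))` of the source `x` with the ENLARGED avoided set `Y ∪ {v}`.  This gives the identity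
(`Consts.chainRuleDet_eq_rowAvoid_add`)

  `Δ = Δ_N + K(S₂,Yv) · [ (K(S₁,Yo) − K(S₁,Yvo)) · K(S₃,Y) − (K(S₁,Y) − K(S₁,Yv)) · K(S₃,Yo) ]`,
  `Δ_N := det [[K(S₁,Yv), K(S₁,Yv), K(S₁,Yvo)], [K(S₂,Yv), K(S₂,Y), K(S₂,Yo)], [0, K(S₃,Y), K(S₃,Yo)]]`,

(`K(S₁,Y) − K(S₁,Yv) = μ{x ↮ Y, v ∈ C_x}`, `K(S₁,Yo) − K(S₁,Yvo) = μ{x ↮ Yo, v ∈ C_x}`), i.e. after division by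
`K(S₁,Y)K(S₂,Y)K(S₃,Y)`: `t₂(a₃ − a₁) − t₁(a₃ − a₂) = t₁·[t₂(a₃ − a₁ᴺ) − (a₃ − a₂)] + t₂ b₁·[a₃ − c₁]` with
`a₁ᴺ = P(o ∈ C_x | x ↮ Y ∪ {v})` and `c₁ = P(o ∈ C_x | x ↮ Y, v ∈ C_x)`.

* `Consts.chainRule_rowAvoid` — **THEOREM `Δ_N ≥ 0`** (the chain rule with the first row conditioned on avoiding `v` as well):
  `Δ_N = K(S₁,Yv) · M + K(S₃,Y) · L'` with
  `L' = K(S₁,Yvo) K(S₂,Yv) − K(S₁,Yv) K(S₂,Yvo) ≥ 0` (reverse regularity of order two, `Consts.disconnect_rr2`, i.e. the source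
  monotonicity `P(o ∈ C_{xu} | xu ↮ Yv) ≥ P(o ∈ C_x | x ↮ Yv)`), and
  `M = K(S₃,Yo) · [K(S₂,Y) − K(S₂,Yv)] − K(S₃,Y) · [K(S₂,Yo) − K(S₂,Yvo)] ≥ 0` (`Consts.real_avoid_reach_mul_le`): on `{S₃ ↮ Y}` the
  increasing cluster event `{v ↔ x} ∪ {v ↔ u}` and the decreasing one `{o ∉ C_{S₃}}` are negatively correlated — the set form of
  van den Berg–Häggström–Kahn's Theorem 1.5 (`setTwoClusterExchange`), using `{S₂ ↮ Y, v ∈ C_{S₂}} = {S₃ ↮ Y, v ↔ S₂}`.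
  Conditional form: `a₂ ≥ t₂ · a₁ᴺ + b₂ · a₃`.
* `Consts.chainRuleDet_nonneg_of_level_three_ge` — **COROLLARY: CR holds in the regime `a₃ ≥ c₁`**, i.e. whenever
  `(K(S₁,Y) − K(S₁,Yv)) · K(S₃,Yo) ≤ (K(S₁,Yo) − K(S₁,Yvo)) · K(S₃,Y)` (`P(o ∈ C_{xuv} | xuv ↮ Y) ≥ P(o ∈ C_x | x ↮ Y, v ∈ C_x)`);
  `Consts.singleEdgeChainRule_at_of_level_three_ge` is the same in the literal form of `Consts.SingleEdgeChainRule`.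
  So the open part of CR is exactly the regime `c₁ > a₃` ("`o` is likelier in the cluster of `x` at level 1, given that this cluster
  already contains `v`, than in the cluster of `{x,u,v}` at level 3"), where the positive term `t₁[t₂(a₃ − a₁ᴺ) − (a₃ − a₂)]` must
  dominate; exact numerics (seat folder `work/explore/test_N1.py`, ≈ 2 000 random weighted graphs `n ≤ 7`): the hypothesis holds in
  ≈ 54 % of instances, CR in 100 %.
[cite: VandenbergHaggstromKahn2005, Thm. 1.5 (p. 7), Thm. 2.1 (p. 9), Remark 1 after Thm. 1.2 (p. 5), Thm. 1.1 (pp. 3–5)]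
-/

noncomputable section

namespace Summit.CriticalPhenomena.PercolationContinuityZ3.Theorems

open MeasureTheory Set Literature.Probability.LatticeModels Literature.Probability.Percolation
open scoped Classical

namespace Consts

/-- Notation (this file only): the disconnection kernel `𝕂[w](S, T) = μ_w{S ↮ T}`. -/
local notation3 "𝕂[" w "](" S ", " T ")" =>
  MeasureTheory.Measure.real (prodBernoulli w) {ω | ∀ s ∈ S, ∀ t ∈ T, ¬ (openGraph ω).Reachable s t}

variable {V : Type*} [Fintype V]

/-! ### Two cluster-event facts -/

omit [Fintype V] in
/-- **Open paths from a source survive an enlargement of the source cluster union.**  If `⋃_{s ∈ S} C_s(ω) ⊆ ⋃_{s ∈ S} C_s(ω')`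
(open EDGE clusters) and `x ∈ S`, then every vertex joined to `x` in `ω` is joined to `x` in `ω'`: the edges of an open `x`-path in
`ω` lie in `C_x(ω)`, hence are open in `ω'`.  (So `{x ↔ a}` with `x ∈ S` is an event of type `(+)` for the pair `(C_S, C_T)`.)
[folklore] -/
theorem reachable_of_biUnion_openEdgeCluster_subset {S : Set V} {x a : V} (hx : x ∈ S) {ω ω' : BondConfig V}
    (hsub : (⋃ s ∈ S, openEdgeCluster ω s) ⊆ (⋃ s ∈ S, openEdgeCluster ω' s))
    (h : (openGraph ω).Reachable x a) : (openGraph ω').Reachable x a := by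
  rw [SimpleGraph.reachable_iff_reflTransGen] at h
  induction h with
  | refl => exact SimpleGraph.Reachable.refl x
  | @tail b c hab hbc ih =>
    obtain ⟨hω, hne⟩ := (openGraph_adj ω b c).1 hbc
    have hb : (openGraph ω).Reachable x b := (SimpleGraph.reachable_iff_reflTransGen x b).2 hab
    have hc : (openGraph ω).Reachable x c := hb.trans hbc.reachable
    -- the edge `s(b,c)` lies in `C_x(ω)`, hence in some `C_s(ω')`, hence is open in `ω'`
    have hmem : s(b, c) ∈ openEdgeCluster ω x := by
      rw [mem_openEdgeCluster_iff]
      refine ⟨hω, ?_, ?_⟩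
      · rw [Sym2.mk_isDiag_iff]; exact hne
      · intro y hy
        rcases Sym2.mem_iff.1 hy with rfl | rfl
        · exact hb
        · exact hc
    have hmem' : s(b, c) ∈ ⋃ s ∈ S, openEdgeCluster ω' s := hsub (mem_biUnion hx hmem)
    obtain ⟨s, -, hs⟩ := mem_iUnion₂.1 hmem'
    have hω' : s(b, c) ∈ ω' := ((mem_openEdgeCluster_iff ω' s _).1 hs).1
    exact ih.trans (SimpleGraph.Adj.reachable ((openGraph_adj ω' b c).2 ⟨hω', hne⟩))

/-- **On `{S₃ ↮ Y}` the events `{v ↔ S₂}` (increasing in the cluster) and `{o ∉ C_{S₃}}` (decreasing) are negatively correlated**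
(`S₂ = {x,u} ⊆ S₃ = {x,u,v}`), in kernel form:
`K(S₃,Y) · [K(S₂,Yo) − K(S₂,Yvo)] ≤ K(S₃,Yo) · [K(S₂,Y) − K(S₂,Yv)]`
(`K(S₂,Y) − K(S₂,Yv) = μ{S₃ ↮ Y, v ↔ S₂}`, `K(S₂,Yo) − K(S₂,Yvo) = μ{S₃ ↮ Y, v ↔ S₂, o ∉ C_{S₃}}`, `K(S₃,Yo) = μ{S₃ ↮ Y, o ∉ C_{S₃}}`).
The set form of van den Berg–Häggström–Kahn's Theorem 1.5 (`setTwoClusterExchange` with `A₂ = B₂ = univ`).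
[cite: VandenbergHaggstromKahn2005, Thm. 2.1 (p. 9) at q = 1, Thm. 1.5 (p. 7), Remark 1 after Thm. 1.2 (p. 5)] -/
theorem real_avoid_reach_mul_le (w : Sym2 V → unitInterval) (x u v o : V) (Y : Set V) :
    𝕂[w](({x, u, v} : Set V), Y) * (𝕂[w](({x, u} : Set V), insert o Y) - 𝕂[w](({x, u} : Set V), insert o (insert v Y))) ≤
      𝕂[w](({x, u, v} : Set V), insert o Y) * (𝕂[w](({x, u} : Set V), Y) - 𝕂[w](({x, u} : Set V), insert v Y)) := by
  classical
  set μ := prodBernoulli w with hμ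
  have hmeas : ∀ T : Set (BondConfig V), MeasurableSet T := fun _ => MeasurableSet.of_discrete
  set S₃ : Set V := {x, u, v} with hS₃
  set D : Set (BondConfig V) := {ω | ∀ s ∈ S₃, ∀ t ∈ Y, ¬ (openGraph ω).Reachable s t} with hD
  -- `A = {v ↔ x} ∪ {v ↔ u}` (type `(+)`), `B = {S₃ ↮ o}` (type `(−)`)
  set A : Set (BondConfig V) := {ω | (openGraph ω).Reachable x v ∨ (openGraph ω).Reachable u v} with hA
  set B : Set (BondConfig V) := ⋂ s ∈ S₃, (⋃ t ∈ S₃, (openConn t o : Set (BondConfig V)))ᶜ with hB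
  have hxS : x ∈ S₃ := by simp [hS₃]
  have huS : u ∈ S₃ := by simp [hS₃]
  have hAtype : ∀ ⦃ω ω' : BondConfig V⦄, (⋃ s ∈ S₃, openEdgeCluster ω s) ⊆ (⋃ s ∈ S₃, openEdgeCluster ω' s) →
      (⋃ t ∈ Y, openEdgeCluster ω' t) ⊆ (⋃ t ∈ Y, openEdgeCluster ω t) → ω ∈ A → ω' ∈ A := by
    intro ω ω' hs _ hω
    rcases hω with h | h
    · exact Or.inl (reachable_of_biUnion_openEdgeCluster_subset hxS hs h)
    · exact Or.inr (reachable_of_biUnion_openEdgeCluster_subset huS hs h)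
  have hBtype : ∀ ⦃ω ω' : BondConfig V⦄, (⋃ s ∈ S₃, openEdgeCluster ω' s) ⊆ (⋃ s ∈ S₃, openEdgeCluster ω s) →
      (⋃ t ∈ Y, openEdgeCluster ω t) ⊆ (⋃ t ∈ Y, openEdgeCluster ω' t) → ω ∈ B → ω' ∈ B := by
    intro ω ω' hs ht hω
    simp only [hB, mem_iInter] at hω ⊢
    intro s hs3
    exact TwoSetExchange.typeMinus_not_biUnion_openConn S₃ Y o hs ht (hω s hs3)
  have huniv : ∀ ⦃ω ω' : BondConfig V⦄, (⋃ s ∈ S₃, openEdgeCluster ω s) ⊆ (⋃ s ∈ S₃, openEdgeCluster ω' s) →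
      (⋃ t ∈ Y, openEdgeCluster ω' t) ⊆ (⋃ t ∈ Y, openEdgeCluster ω t) → ω ∈ (univ : Set (BondConfig V)) →
      ω' ∈ (univ : Set (BondConfig V)) := fun _ _ _ _ _ => mem_univ _
  have huniv' : ∀ ⦃ω ω' : BondConfig V⦄, (⋃ s ∈ S₃, openEdgeCluster ω' s) ⊆ (⋃ s ∈ S₃, openEdgeCluster ω s) →
      (⋃ t ∈ Y, openEdgeCluster ω t) ⊆ (⋃ t ∈ Y, openEdgeCluster ω' t) → ω ∈ (univ : Set (BondConfig V)) →
      ω' ∈ (univ : Set (BondConfig V)) := fun _ _ _ _ _ => mem_univ _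
  have key := setTwoClusterExchange w S₃ Y (A₁ := A) (A₂ := univ) (B₁ := B) (B₂ := univ) hAtype huniv hBtype huniv'
  simp only [inter_univ] at key
  -- key : μ.real (D ∩ (A ∩ B)) * μ.real D ≤ μ.real (D ∩ A) * μ.real (D ∩ B)
  -- `B` as a plain avoidance event: `ω ∈ B ↔ ∀ s ∈ S₃, ¬ s ↔ o`
  have hBiff : ∀ ω : BondConfig V, ω ∈ B ↔ ∀ s ∈ S₃, ¬ (openGraph ω).Reachable s o := by
    intro ω
    simp only [hB, mem_iInter, mem_compl_iff, mem_iUnion, not_exists, openConn, mem_setOf_eq]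
    constructor
    · intro h s hs hso
      exact h s hs s hs hso
    · intro h s _ t ht hto
      exact h t ht hto
  -- membership in `D`, `A`, `B` spelled out on the three named sources
  have hDiff : ∀ ω : BondConfig V, ω ∈ D ↔ (∀ t ∈ Y, ¬ (openGraph ω).Reachable x t) ∧
      (∀ t ∈ Y, ¬ (openGraph ω).Reachable u t) ∧ (∀ t ∈ Y, ¬ (openGraph ω).Reachable v t) := by
    intro ω
    simp only [hD, hS₃, mem_setOf_eq, mem_insert_iff, mem_singleton_iff, forall_eq_or_imp, forall_eq]
  have hBiff' : ∀ ω : BondConfig V, ω ∈ B ↔ ¬ (openGraph ω).Reachable x o ∧ ¬ (openGraph ω).Reachable u o ∧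
      ¬ (openGraph ω).Reachable v o := by
    intro ω
    rw [hBiff ω]
    simp only [hS₃, mem_insert_iff, mem_singleton_iff, forall_eq_or_imp, forall_eq]
  -- (1) `K(S₂,Y) − K(S₂,Yv) = μ(D ∩ A)`
  have hsub1 : {ω : BondConfig V | ∀ s ∈ ({x, u} : Set V), ∀ t ∈ insert v Y, ¬ (openGraph ω).Reachable s t} ⊆
      {ω : BondConfig V | ∀ s ∈ ({x, u} : Set V), ∀ t ∈ Y, ¬ (openGraph ω).Reachable s t} := by
    intro ω h; simp only [mem_setOf_eq] at h ⊢
    exact fun s hs t ht => h s hs t (mem_insert_of_mem _ ht)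
  have hdiff1 : {ω : BondConfig V | ∀ s ∈ ({x, u} : Set V), ∀ t ∈ Y, ¬ (openGraph ω).Reachable s t} \
      {ω : BondConfig V | ∀ s ∈ ({x, u} : Set V), ∀ t ∈ insert v Y, ¬ (openGraph ω).Reachable s t} = D ∩ A := by
    ext ω
    rw [mem_inter_iff, hDiff ω]
    simp only [mem_sdiff, mem_setOf_eq, mem_insert_iff, mem_singleton_iff, forall_eq_or_imp, forall_eq, hA]
    constructor
    · rintro ⟨⟨hx, hu⟩, h2⟩
      -- some source of `S₂` reaches `v`
      have hor : (openGraph ω).Reachable x v ∨ (openGraph ω).Reachable u v := by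
        by_contra hno
        rw [not_or] at hno
        exact h2 ⟨⟨hno.1, hx⟩, ⟨hno.2, hu⟩⟩
      refine ⟨⟨hx, hu, ?_⟩, hor⟩
      intro t ht hvt
      rcases hor with hxv | huv
      · exact hx t ht (hxv.trans hvt)
      · exact hu t ht (huv.trans hvt)
    · rintro ⟨⟨hx, hu, -⟩, hor⟩
      refine ⟨⟨hx, hu⟩, fun h => ?_⟩
      rcases hor with hxv | huv
      · exact h.1.1 hxv
      · exact h.2.1 huv
  have e1 : 𝕂[w](({x, u} : Set V), Y) - 𝕂[w](({x, u} : Set V), insert v Y) = μ.real (D ∩ A) := by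
    rw [← hdiff1, measureReal_sdiff hsub1 (hmeas _)]
  -- (2) `K(S₂,Yo) − K(S₂,Yvo) = μ(D ∩ (A ∩ B))`
  have hsub2 : {ω : BondConfig V | ∀ s ∈ ({x, u} : Set V), ∀ t ∈ insert o (insert v Y), ¬ (openGraph ω).Reachable s t} ⊆
      {ω : BondConfig V | ∀ s ∈ ({x, u} : Set V), ∀ t ∈ insert o Y, ¬ (openGraph ω).Reachable s t} := by
    intro ω h; simp only [mem_setOf_eq] at h ⊢
    intro s hs t ht
    rcases mem_insert_iff.1 ht with rfl | ht'
    · exact h s hs t (mem_insert _ _)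
    · exact h s hs t (mem_insert_of_mem _ (mem_insert_of_mem _ ht'))
  have hdiff2 : {ω : BondConfig V | ∀ s ∈ ({x, u} : Set V), ∀ t ∈ insert o Y, ¬ (openGraph ω).Reachable s t} \
      {ω : BondConfig V | ∀ s ∈ ({x, u} : Set V), ∀ t ∈ insert o (insert v Y), ¬ (openGraph ω).Reachable s t} =
      D ∩ (A ∩ B) := by
    ext ω
    rw [mem_inter_iff, mem_inter_iff, hDiff ω, hBiff' ω]
    simp only [mem_sdiff, mem_setOf_eq, mem_insert_iff, mem_singleton_iff, forall_eq_or_imp, forall_eq, hA]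
    constructor
    · rintro ⟨⟨⟨hxo, hx⟩, ⟨huo, hu⟩⟩, h2⟩
      have hor : (openGraph ω).Reachable x v ∨ (openGraph ω).Reachable u v := by
        by_contra hno
        rw [not_or] at hno
        exact h2 ⟨⟨hxo, hno.1, hx⟩, ⟨huo, hno.2, hu⟩⟩
      refine ⟨⟨hx, hu, ?_⟩, hor, hxo, huo, ?_⟩
      · intro t ht hvt
        rcases hor with hxv | huv
        · exact hx t ht (hxv.trans hvt)
        · exact hu t ht (huv.trans hvt)
      · intro hvo
        rcases hor with hxv | huv
        · exact hxo (hxv.trans hvo)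
        · exact huo (huv.trans hvo)
    · rintro ⟨⟨hx, hu, -⟩, hor, hxo, huo, -⟩
      refine ⟨⟨⟨hxo, hx⟩, ⟨huo, hu⟩⟩, fun h => ?_⟩
      rcases hor with hxv | huv
      · exact h.1.2.1 hxv
      · exact h.2.2.1 huv
  have e2 : 𝕂[w](({x, u} : Set V), insert o Y) - 𝕂[w](({x, u} : Set V), insert o (insert v Y)) =
      μ.real (D ∩ (A ∩ B)) := by
    rw [← hdiff2, measureReal_sdiff hsub2 (hmeas _)]
  -- (3) `K(S₃,Yo) = μ(D ∩ B)` and `K(S₃,Y) = μ(D)`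
  have hDB : {ω : BondConfig V | ∀ s ∈ ({x, u, v} : Set V), ∀ t ∈ insert o Y, ¬ (openGraph ω).Reachable s t} = D ∩ B := by
    ext ω
    rw [mem_inter_iff, hDiff ω, hBiff' ω]
    simp only [mem_setOf_eq, mem_insert_iff, mem_singleton_iff, forall_eq_or_imp, forall_eq]
    tauto
  have e3 : 𝕂[w](({x, u, v} : Set V), insert o Y) = μ.real (D ∩ B) := by
    show μ.real _ = _; rw [hDB]
  have e4 : 𝕂[w](({x, u, v} : Set V), Y) = μ.real D := rfl
  rw [e1, e2, e3, e4]
  calc μ.real D * μ.real (D ∩ (A ∩ B)) = μ.real (D ∩ (A ∩ B)) * μ.real D := mul_comm _ _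
    _ ≤ μ.real (D ∩ A) * μ.real (D ∩ B) := key
    _ = μ.real (D ∩ B) * μ.real (D ∩ A) := mul_comm _ _

/-! ### The row-avoiding chain rule `Δ_N ≥ 0` -/

omit [Fintype V] in
/-- `K(S₃, Y ∪ v) = 0`: the source set `{x,u,v}` never avoids `v`. [folklore] -/
theorem real_avoid_triple_insert_self (w : Sym2 V → unitInterval) (x u v : V) (Y : Set V) :
    𝕂[w](({x, u, v} : Set V), insert v Y) = 0 := by
  have : {ω : BondConfig V | ∀ s ∈ ({x, u, v} : Set V), ∀ t ∈ insert v Y, ¬ (openGraph ω).Reachable s t} = ∅ := by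
    ext ω
    simp only [mem_setOf_eq, mem_empty_iff_false, iff_false, not_forall, not_not]
    exact ⟨v, by simp, v, mem_insert _ _, SimpleGraph.Reachable.refl _⟩
  rw [this]; simp

/-- **THEOREM — the row-avoiding chain rule.**  For every finite weighted graph and all `x, u, v, o, Y`:
`0 ≤ det [[K(x,Yv), K(x,Yv), K(x,Yvo)], [K(xu,Yv), K(xu,Y), K(xu,Yo)], [K(xuv,Yv) (= 0), K(xuv,Y), K(xuv,Yo)]]`
— the chain-rule minor of `Consts.SingleEdgeChainRule` with its first row (source `x`) computed for the enlarged avoided set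
`Y ∪ {v}`; in conditional form `P(o ∈ C_{xu} | xu ↮ Y) ≥ P(v ∉ C_{xu} | xu ↮ Y)·P(o ∈ C_x | x ↮ Y∪v) + P(v ∈ C_{xu} | xu ↮ Y)·P(o ∈ C_{xuv} | xuv ↮ Y)`.
Proof: the determinant equals `K(x,Yv)·M + K(xuv,Y)·L'` with `M ≥ 0` (`Consts.real_avoid_reach_mul_le`) and
`L' = K(x,Yvo)K(xu,Yv) − K(x,Yv)K(xu,Yvo) ≥ 0` (`Consts.disconnect_rr2`).
[cite: VandenbergHaggstromKahn2005, Thm. 1.5 (p. 7), Thm. 2.1 (p. 9)] -/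
theorem chainRule_rowAvoid (w : Sym2 V → unitInterval) (x u v o : V) (Y : Set V) :
    0 ≤ Matrix.det !![
      𝕂[w](({x} : Set V), insert v Y), 𝕂[w](({x} : Set V), insert v Y), 𝕂[w](({x} : Set V), insert o (insert v Y));
      𝕂[w](({x, u} : Set V), insert v Y), 𝕂[w](({x, u} : Set V), Y), 𝕂[w](({x, u} : Set V), insert o Y);
      𝕂[w](({x, u, v} : Set V), insert v Y), 𝕂[w](({x, u, v} : Set V), Y), 𝕂[w](({x, u, v} : Set V), insert o Y)] := by
  classical
  set K1v := 𝕂[w](({x} : Set V), insert v Y) with hK1v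
  set K1vo := 𝕂[w](({x} : Set V), insert o (insert v Y)) with hK1vo
  set K2v := 𝕂[w](({x, u} : Set V), insert v Y) with hK2v
  set K2 := 𝕂[w](({x, u} : Set V), Y) with hK2
  set K2o := 𝕂[w](({x, u} : Set V), insert o Y) with hK2o
  set K2vo := 𝕂[w](({x, u} : Set V), insert o (insert v Y)) with hK2vo
  set K3v := 𝕂[w](({x, u, v} : Set V), insert v Y) with hK3v
  set K3 := 𝕂[w](({x, u, v} : Set V), Y) with hK3
  set K3o := 𝕂[w](({x, u, v} : Set V), insert o Y) with hK3o
  have hK3v0 : K3v = 0 := real_avoid_triple_insert_self w x u v Y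
  -- `M ≥ 0` and `L' ≥ 0`
  have hM : K3 * (K2o - K2vo) ≤ K3o * (K2 - K2v) := real_avoid_reach_mul_le w x u v o Y
  have hS : ({x} : Set V) ⊆ ({x, u} : Set V) := by
    intro s hs; rw [mem_singleton_iff] at hs; subst hs; exact mem_insert _ _
  have hT : insert v Y ⊆ insert o (insert v Y) := subset_insert _ _
  have hL : K1v * K2vo ≤ K1vo * K2v := disconnect_rr2 w hS hT
  have h1 : 0 ≤ K1v := measureReal_nonneg
  have h3 : 0 ≤ K3 := measureReal_nonneg
  have hdet : Matrix.det !![K1v, K1v, K1vo; K2v, K2, K2o; K3v, K3, K3o] =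
      K1v * (K3o * (K2 - K2v) - K3 * (K2o - K2vo)) + K3 * (K1vo * K2v - K1v * K2vo) := by
    rw [Matrix.det_fin_three]
    simp only [Matrix.of_apply, Matrix.cons_val', Matrix.cons_val_zero, Matrix.cons_val_one, Matrix.cons_val_two,
      Matrix.empty_val', Matrix.cons_val_fin_one, Matrix.head_cons, Matrix.tail_cons, Matrix.head_fin_const, hK3v0]
    ring
  rw [hdet]
  exact add_nonneg (mul_nonneg h1 (by linarith)) (mul_nonneg h3 (by linarith))

/-! ### The row-split identity and the chain rule in the regime `a₃ ≥ c₁` -/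

omit [Fintype V] in
/-- **IDENTITY — row-split normal form of the chain-rule minor.**  With `Δ` the minor of `Consts.SingleEdgeChainRule` and `Δ_N` the
row-avoiding minor of `Consts.chainRule_rowAvoid`:
`Δ = Δ_N + K(xu,Yv) · [ (K(x,Yo) − K(x,Yvo)) · K(xuv,Y) − (K(x,Y) − K(x,Yv)) · K(xuv,Yo) ]`
(linearity of the determinant in its first row, `K(x,T) = K(x,T∪v) + μ{x ↮ T, v ∈ C_x}`, and `K(xuv,Yv) = 0`).
[cite: VandenbergHaggstromKahn2005, Thm. 1.1 (pp. 3–5)] -/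
theorem chainRuleDet_eq_rowAvoid_add (w : Sym2 V → unitInterval) (x u v o : V) (Y : Set V) :
    Matrix.det !![
      𝕂[w](({x} : Set V), insert v Y), 𝕂[w](({x} : Set V), Y), 𝕂[w](({x} : Set V), insert o Y);
      𝕂[w](({x, u} : Set V), insert v Y), 𝕂[w](({x, u} : Set V), Y), 𝕂[w](({x, u} : Set V), insert o Y);
      𝕂[w](({x, u, v} : Set V), insert v Y), 𝕂[w](({x, u, v} : Set V), Y), 𝕂[w](({x, u, v} : Set V), insert o Y)] =
    Matrix.det !![
      𝕂[w](({x} : Set V), insert v Y), 𝕂[w](({x} : Set V), insert v Y), 𝕂[w](({x} : Set V), insert o (insert v Y));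
      𝕂[w](({x, u} : Set V), insert v Y), 𝕂[w](({x, u} : Set V), Y), 𝕂[w](({x, u} : Set V), insert o Y);
      𝕂[w](({x, u, v} : Set V), insert v Y), 𝕂[w](({x, u, v} : Set V), Y), 𝕂[w](({x, u, v} : Set V), insert o Y)] +
    𝕂[w](({x, u} : Set V), insert v Y) *
      ((𝕂[w](({x} : Set V), insert o Y) - 𝕂[w](({x} : Set V), insert o (insert v Y))) * 𝕂[w](({x, u, v} : Set V), Y) -
        (𝕂[w](({x} : Set V), Y) - 𝕂[w](({x} : Set V), insert v Y)) * 𝕂[w](({x, u, v} : Set V), insert o Y)) := by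
  classical
  have hK3v0 : 𝕂[w](({x, u, v} : Set V), insert v Y) = 0 := real_avoid_triple_insert_self w x u v Y
  rw [Matrix.det_fin_three, Matrix.det_fin_three]
  simp only [Matrix.of_apply, Matrix.cons_val', Matrix.cons_val_zero, Matrix.cons_val_one, Matrix.cons_val_two,
    Matrix.empty_val', Matrix.cons_val_fin_one, Matrix.head_cons, Matrix.tail_cons, Matrix.head_fin_const, hK3v0]
  ring

/-- **COROLLARY — the single-edge chain rule in the regime `a₃ ≥ c₁`.**  If
`(K(x,Y) − K(x,Yv)) · K(xuv,Yo) ≤ (K(x,Yo) − K(x,Yvo)) · K(xuv,Y)`, i.e. `μ{x ↮ Y, v ∈ C_x} · μ{xuv ↮ Yo} ≤ μ{x ↮ Yo, v ∈ C_x} · μ{xuv ↮ Y}`,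
i.e. `P(o ∈ C_{xuv} | xuv ↮ Y) ≥ P(o ∈ C_x | x ↮ Y, v ∈ C_x)`, then the chain-rule minor is nonnegative.
[cite: VandenbergHaggstromKahn2005, Thm. 1.5 (p. 7), Thm. 1.1 (pp. 3–5)] -/
theorem chainRuleDet_nonneg_of_level_three_ge (w : Sym2 V → unitInterval) (x u v o : V) (Y : Set V)
    (h : (𝕂[w](({x} : Set V), Y) - 𝕂[w](({x} : Set V), insert v Y)) * 𝕂[w](({x, u, v} : Set V), insert o Y) ≤
      (𝕂[w](({x} : Set V), insert o Y) - 𝕂[w](({x} : Set V), insert o (insert v Y))) * 𝕂[w](({x, u, v} : Set V), Y)) :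
    0 ≤ Matrix.det !![
      𝕂[w](({x} : Set V), insert v Y), 𝕂[w](({x} : Set V), Y), 𝕂[w](({x} : Set V), insert o Y);
      𝕂[w](({x, u} : Set V), insert v Y), 𝕂[w](({x, u} : Set V), Y), 𝕂[w](({x, u} : Set V), insert o Y);
      𝕂[w](({x, u, v} : Set V), insert v Y), 𝕂[w](({x, u, v} : Set V), Y), 𝕂[w](({x, u, v} : Set V), insert o Y)] := by
  rw [chainRuleDet_eq_rowAvoid_add]
  exact add_nonneg (chainRule_rowAvoid w x u v o Y) (mul_nonneg measureReal_nonneg (sub_nonneg.2 h))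

/-- **COROLLARY (literal form) — the instance of `Consts.SingleEdgeChainRule` at `(x,u,v,o,Y)` holds whenever
`μ{x ↮ Y, v ∈ C_x} · μ{xuv ↮ Yo} ≤ μ{x ↮ Yo, v ∈ C_x} · μ{xuv ↮ Y}`** (the regime `a₃ ≥ c₁`), via
`Consts.singleEdgeChainRule_slack_eq_det`. [cite: VandenbergHaggstromKahn2005, Thm. 1.5 (p. 7), Thm. 1.1 (pp. 3–5)] -/
theorem singleEdgeChainRule_at_of_level_three_ge (w : Sym2 V → unitInterval) (x u v o : V) (Y : Set V)
    (h : (𝕂[w](({x} : Set V), Y) - 𝕂[w](({x} : Set V), insert v Y)) * 𝕂[w](({x, u, v} : Set V), insert o Y) ≤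
      (𝕂[w](({x} : Set V), insert o Y) - 𝕂[w](({x} : Set V), insert o (insert v Y))) * 𝕂[w](({x, u, v} : Set V), Y)) :
    (prodBernoulli w).real ({ω : BondConfig V | ∀ y ∈ Y, ¬ (openGraph ω).Reachable x y} ∩
          {ω | ¬ (openGraph ω).Reachable x v}) *
        ((prodBernoulli w).real
              ({ω : BondConfig V | ∀ y ∈ Y, ¬ (openGraph ω).Reachable x y ∧ ¬ (openGraph ω).Reachable u y ∧
                  ¬ (openGraph ω).Reachable v y} ∩ (openConn x o ∪ openConn u o ∪ openConn v o)) *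
            (prodBernoulli w).real
              {ω : BondConfig V | ∀ y ∈ Y, ¬ (openGraph ω).Reachable x y ∧ ¬ (openGraph ω).Reachable u y} -
          (prodBernoulli w).real
              ({ω : BondConfig V | ∀ y ∈ Y, ¬ (openGraph ω).Reachable x y ∧ ¬ (openGraph ω).Reachable u y} ∩
                (openConn x o ∪ openConn u o)) *
            (prodBernoulli w).real
              {ω : BondConfig V | ∀ y ∈ Y, ¬ (openGraph ω).Reachable x y ∧ ¬ (openGraph ω).Reachable u y ∧
                ¬ (openGraph ω).Reachable v y}) ≤
      (prodBernoulli w).real ({ω : BondConfig V | ∀ y ∈ Y, ¬ (openGraph ω).Reachable x y ∧ ¬ (openGraph ω).Reachable u y} ∩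
          {ω | ¬ (openGraph ω).Reachable x v ∧ ¬ (openGraph ω).Reachable u v}) *
        ((prodBernoulli w).real
              ({ω : BondConfig V | ∀ y ∈ Y, ¬ (openGraph ω).Reachable x y ∧ ¬ (openGraph ω).Reachable u y ∧
                  ¬ (openGraph ω).Reachable v y} ∩ (openConn x o ∪ openConn u o ∪ openConn v o)) *
            (prodBernoulli w).real {ω : BondConfig V | ∀ y ∈ Y, ¬ (openGraph ω).Reachable x y} -
          (prodBernoulli w).real ({ω : BondConfig V | ∀ y ∈ Y, ¬ (openGraph ω).Reachable x y} ∩ openConn x o) *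
            (prodBernoulli w).real
              {ω : BondConfig V | ∀ y ∈ Y, ¬ (openGraph ω).Reachable x y ∧ ¬ (openGraph ω).Reachable u y ∧
                ¬ (openGraph ω).Reachable v y}) := by
  rw [← sub_nonneg, singleEdgeChainRule_slack_eq_det]
  exact chainRuleDet_nonneg_of_level_three_ge w x u v o Y h

end Consts

end Summit.CriticalPhenomena.PercolationContinuityZ3.Theorems

end
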